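import Mathlib
import HarnessLib
import Summits.BirchSwinnertonDyer.BirchSwinnertonDyer.Theses.ManinLocalTwoThree
import Summits.BirchSwinnertonDyer.BirchSwinnertonDyer.Theorems.ManinLocalTwoThreeManinOfStevensConjectures

/-!
# Lines/stevens_minimal_candidate.lean — CANDIDATE line for C2 `ManinOddAtFour` (lead p1 gen 14, 2026-08-29; NOT registered — v21 stays of record)
# «STEVENS-MINIMAL»: C2 ⟸ F-need ∧ Stevens I ∧ Stevens II ∧ E-an-152b, composition = `maninOddAtFour_of_stevensConjectures` (p716357).

THE IDEA.  The tree's Γ₀/Γ₁ ledger gives `c₁ ∣ c₀ ∣ 2c₁` at `4 ∣ N`; C2 = (c₁ odd) ∧ (no doubling).  Stevens' Conjecture I (`c₁ = ±1`,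
tree `ManinConstant.StevensConstantOne`) supplies the first; the lead's covolume lemma `index_four_of_maxCovolume_of_natAbs_eq_two_mul` shows that
Stevens' Conjecture II («the `X₁(N)`-optimal curve is the minimal (= maximal-covolume) curve of its class», tree predicate
`KatoCurve.IsMaxCovolumeInClass`) excludes doubling except in the index-`4` configuration `Λ₁(f) = 2Λ₀(f)`, which is E-an-152b
`ShimuraIndexNeFourAtFour` (census 0/338; theorem at `N = 4q`, `(ℤ/q)ˣ` cyclic).  FOUR stubs, two of them PUBLISHED conjectures (Stevens 1989),
one printed existence fact (F-need), one cell law.  WHY NOT OF RECORD: Stevens I is Manin-strength on the `X₁` side (Manin ⟹ Stevens I by ČNS 6.5), so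
the line isolates the TRANSFER, it does not lower the arithmetic depth; v21 (Kato road) keeps finer, census-backed laws.  Value: the cleanest
statement of what C2 needs beyond print — «Stevens II + index ≠ 4» for the transfer.
HONEST FRAMING: CONDITIONAL; all four stubs OPEN / statement-only; BSD is not proved; Manin's conjecture is not proved; C2 OPEN.
-/

set_option autoImplicit false
set_option linter.dupNamespace false

noncomputable section

open WeierstrassCurve Literature.NumberTheory.EllipticCurves Literature.NumberTheory.EllipticCurves.ModularForms
open Summit.BirchSwinnertonDyer.Rank1Residual.ManinAdditive.ShimuraKernel
open Summit.BirchSwinnertonDyer.Rank1Residual.ManinAdditive.KatoCurve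
open Summit.BirchSwinnertonDyer.Rank1Residual.ManinConstant

namespace Summit.BirchSwinnertonDyer.BirchSwinnertonDyer.Cruxes.ManinOddAtFour.StevensMinimal

/-- STUB 1 — F-need BY NAME (printed: Stevens 1989 §2 / CES 2003 §6.1; statement-only Literature fact): the class of every lattice-optimal
`X₀(N)`-datum carries an OPTIMAL `X₁(N)`-datum. -/
theorem stub_existsOptimalGamma1Datum : exists_optimal_gamma1ParametrizationData := by
  sorry

/-- STUB 2 — STEVENS' CONJECTURE I BY NAME (`ManinConstant.StevensConstantOne`, 1989; OPEN): `|c₁| = 1` for optimal `X₁(N)`-data. -/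
theorem stub_stevensConstantOne : StevensConstantOne := by
  sorry

/-- STUB 3 — STEVENS' CONJECTURE II, lattice form (inline; 1989, Conjecture II with Thm. 2.3; OPEN): the curve of an optimal `X₁(N)`-datum at
`4 ∣ N` has MAXIMAL Néron covolume in its isogeny class (tree predicate `KatoCurve.IsMaxCovolumeInClass`).  (Ask T-p1-g14-1: name it.) -/
theorem stub_stevensMinimal :
    ∀ (W₁ : WeierstrassCurve ℚ) [W₁.IsElliptic] [W₁.IsGloballyMinimal] {N : ℕ} [NeZero N]
      (D₁ : Gamma1ParametrizationData W₁ N), D₁.IsOptimal → 2 ^ 2 ∣ N → IsMaxCovolumeInClass W₁ := by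
  sorry

/-- STUB 4 — E-an-152b BY NAME (`ShimuraKernel.ShimuraIndexNeFourAtFour`; cell law, census 0/338; OPEN): no lattice-optimal `X₀(N)`-datum at
`4 ∣ N` has `Λ₁(f) = 2Λ₀(f)`. -/
theorem stub_shimuraIndexNeFour : ShimuraIndexNeFourAtFour := by
  sorry

/-- COMPOSITION (no sorry): the lead's `maninOddAtFour_of_stevensConjectures` (p716357). -/
theorem ManinOddAtFour_of :
    Summit.BirchSwinnertonDyer.BirchSwinnertonDyer.Theses.ManinLocalTwoThree.ManinOddAtFour :=
  Summit.BirchSwinnertonDyer.BirchSwinnertonDyer.Theorems.ManinLocalTwoThree.maninOddAtFour_of_stevensConjectures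
    stub_existsOptimalGamma1Datum stub_stevensConstantOne stub_stevensMinimal stub_shimuraIndexNeFour

end Summit.BirchSwinnertonDyer.BirchSwinnertonDyer.Cruxes.ManinOddAtFour.StevensMinimal

end
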